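import Literature.Probability.LatticeModels.StarBoundaryBox
import HarnessLib

/-!
# Lemma B.82 RELATIVE TO A VERTEX SET `V ⊆ ℤ^d` whose `★`-triangles generate its `★`-cycle space

builds on p205010 (kernel theorem, internal audit signed; external expert review pending) — NOT used in this file.
Lane `prim-bschramm`, seat `prim-bschramm-p2` (gen 25; class C1b; memo `HOME/bschramm/P2-LATTICES.md` §90, the HORN PROGRAMME);
helper file (`--supports stmt-CriticalPhenomena-4575 --as helper`).

`StarBoundaryBox.lean` proves Friedli–Velenik's Lemma B.82 for the `★`-graph induced on a coordinate box `Λ`.  Its proof uses the box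
only through (a) Lemma B.81 for the `★`-triangles of `Λ` and (b) the `★`-connectedness of `Λ`.  Here both are HYPOTHESES on an arbitrary
vertex set `V ⊆ ℤ^d` — (a) in the exact shape `exists_generator_crossing_both_rel` consumes (supplied for `1`-Lipschitz retracts by
`StarRetract.gen_of_retract`, file `StarRetractCycles`), (b) as `StarConn V` — and the statements are re-typed verbatim:
* **`starConn_boundary_pick_gen`** — `A ⊆ V` with `A` and `V ∖ A` `★`-connected, `pick a b ∈ {a, b}`: the picked endpoints of the
  `★`-edges `ab` (`a ∈ A`, `b ∈ V ∖ A`) form a `★`-connected set; **`starConn_exBoundary_gen`**, **`starConn_inBoundary_gen`**;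
* **`starConn_sdiff_of_starComponent_gen`** — `V` `★`-connected, `K ⊆ V` `★`-connected, `A` a `★`-component of `V ∖ K` ⇒ `V ∖ A` is
  `★`-connected; **`starConn_boundary_pick_gen_of_starComponent`** — the components form contour arguments consume (Deuschel–Pisztora's
  Lemma 2.1 (ii) situation), for every region `V` with (a) and (b): truncated horns, staircase regions, unions of boxes.
[cite: FriedliVelenik2017, App. B.15, Lemmas B.82–B.83; §7.2.6 Exercise 7.11] [cite: Timar2013, Theorem 3] [cite: DeuschelPisztora1996, Lemma 2.1 (ii) (p. 471)]
-/

noncomputable section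

open Finset SimpleGraph Relation
open Literature.Combinatorics.SimpleGraph.CycleSpace Literature.Probability.LatticeModels

namespace Summit.CriticalPhenomena.PercolationContinuityZ3.Theorems.Transplant

namespace StarRetract

variable {d : ℕ}

/-- **Lemma B.82 relative to `V`, two-in-one form.** Let `V ⊆ ℤ^d` be a vertex set whose `★`-triangles generate the even `★`-edge sets
with endpoints in `V` (`hgen`), let `A ⊆ V` with `A` and `V ∖ A` `★`-connected, and choose an endpoint `pick a b ∈ {a, b}` for every pair.
Then the set of points `pick a b` over the `★`-edges `ab` with `a ∈ A`, `b ∈ V ∖ A` is `★`-connected.  Proof verbatim as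
`starConn_boundary_pick_box`, with Lemma B.83 relative to `V`.
[cite: FriedliVelenik2017, App. B.15, Lemma B.82 (proof via Lemmas B.81, B.83)] [cite: Timar2013, Theorem 3] -/
theorem starConn_boundary_pick_gen {V : Set (Site d)}
    (hgen : ∀ Z : Finset (Sym2 (Site d)), (∀ e ∈ Z, e ∈ (zdStar d).edgeSet ∧ ∀ x ∈ e, x ∈ V) → IsEvenEdgeSet Z →
      InSpan {T | T ∈ starTriangles d ∧ ∀ e ∈ T, ∀ x ∈ e, x ∈ V} Z)
    {A : Finset (Site d)} (hAV : ∀ a ∈ A, a ∈ V) (hA : StarConn (A : Set (Site d))) (hAc : StarConn (V \ ↑A))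
    (pick : Site d → Site d → Site d) (hpick : ∀ a b, pick a b = a ∨ pick a b = b) :
    StarConn {z | ∃ a b, a ∈ A ∧ b ∈ V ∧ b ∉ A ∧ (zdStar d).Adj a b ∧ pick a b = z} := by
  classical
  set P : Set (Site d) := {z | ∃ a b, a ∈ A ∧ b ∈ V ∧ b ∉ A ∧ (zdStar d).Adj a b ∧ pick a b = z} with hP
  intro x hx y hy
  by_contra hxy
  obtain ⟨ax, bx, hax, hbxV, hbx, hadjx, hpx⟩ := hx
  obtain ⟨ay, cy, hay, hcyV, hcy, hadjy, hpy⟩ := hy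
  -- the boundary `★`-edges inside `V`
  set E : Finset (Sym2 (Site d)) :=
    A.biUnion fun a => ((starBall a).filter fun b => b ∉ A ∧ b ∈ V).image fun b => s(a, b) with hE'
  have hE : ∀ e, e ∈ E ↔ ∃ a b, a ∈ A ∧ b ∈ V ∧ b ∉ A ∧ (zdStar d).Adj a b ∧ e = s(a, b) := by
    intro e
    simp only [hE', mem_biUnion, mem_image, mem_filter]
    constructor
    · rintro ⟨a, ha, b, ⟨hb, hbA, hbV⟩, rfl⟩
      exact ⟨a, b, ha, hbV, hbA, adj_iff_mem_starBall.2 ⟨hb, fun h => hbA (h ▸ ha)⟩, rfl⟩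
    · rintro ⟨a, b, ha, hbV, hbA, hadj, rfl⟩
      exact ⟨a, ha, b, ⟨(adj_iff_mem_starBall.1 hadj).1, hbA, hbV⟩, rfl⟩
  -- a boundary edge has a unique orientation from `A` to `V ∖ A`
  have horient : ∀ a b a' b', a ∈ A → b ∉ A → a' ∈ A → b' ∉ A → s(a, b) = s(a', b') → a = a' ∧ b = b' := by
    intro a b a' b' ha hb ha' hb' h
    rcases Sym2.eq_iff.1 h with ⟨h1, h2⟩ | ⟨h1, h2⟩
    · exact ⟨h1, h2⟩
    · exact absurd (h1 ▸ ha) hb'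
  -- the class of `x` and the induced splitting of the boundary edges
  set P₁ : Set (Site d) := {z | ReflTransGen (starRel P) x z} with hP₁
  set E₁ : Finset (Sym2 (Site d)) :=
    E.filter fun e => ∃ a b, a ∈ A ∧ b ∉ A ∧ e = s(a, b) ∧ pick a b ∈ P₁ with hE₁
  set E₂ : Finset (Sym2 (Site d)) :=
    E.filter fun e => ∃ a b, a ∈ A ∧ b ∉ A ∧ e = s(a, b) ∧ pick a b ∉ P₁ with hE₂
  -- connectivity in walk form: inside `A`, and inside `V ∖ A`
  have hA' : ∀ a ∈ A, ∀ a' ∈ A, ∃ p : (zdStar d).Walk a a', ∀ w ∈ p.support, w ∈ A := by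
    intro a ha a' ha'
    obtain ⟨p, hp⟩ := exists_walk_of_reflTransGen (hA a (mem_coe.2 ha) a' (mem_coe.2 ha')) (mem_coe.2 ha)
    exact ⟨p, fun w hw => mem_coe.1 (hp w hw)⟩
  have hAc' : ∀ b ∈ V, b ∉ A → ∀ b' ∈ V, b' ∉ A →
      ∃ p : (zdStar d).Walk b b', ∀ w ∈ p.support, w ∈ V ∧ w ∉ A := by
    intro b hb hbA b' hb' hb'A
    have hb1 : b ∈ V \ ↑A := ⟨hb, fun h => hbA (mem_coe.1 h)⟩
    have hb1' : b' ∈ V \ ↑A := ⟨hb', fun h => hb'A (mem_coe.1 h)⟩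
    obtain ⟨p, hp⟩ := exists_walk_of_reflTransGen (hAc b hb1 b' hb1') hb1
    exact ⟨p, fun w hw => ⟨(hp w hw).1, fun h => (hp w hw).2 (mem_coe.2 h)⟩⟩
  -- the splitting is a partition of the `★`-edges inside `V` crossing `A`
  have hEpart : ∀ e, e ∈ E₁ ∨ e ∈ E₂ ↔
      e ∈ (zdStar d).edgeSet ∧ (∀ v ∈ e, v ∈ V) ∧ Crosses A e := by
    intro e
    constructor
    · rintro (h | h)
      · obtain ⟨a, b, ha, hbV, hb, hadj, rfl⟩ := (hE e).1 (mem_filter.1 h).1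
        refine ⟨(mem_edgeSet _).2 hadj, fun v hv => ?_, (crosses_mk A a b).2 (Or.inl ⟨ha, hb⟩)⟩
        rcases Sym2.mem_iff.1 hv with rfl | rfl
        · exact hAV _ ha
        · exact hbV
      · obtain ⟨a, b, ha, hbV, hb, hadj, rfl⟩ := (hE e).1 (mem_filter.1 h).1
        refine ⟨(mem_edgeSet _).2 hadj, fun v hv => ?_, (crosses_mk A a b).2 (Or.inl ⟨ha, hb⟩)⟩
        rcases Sym2.mem_iff.1 hv with rfl | rfl
        · exact hAV _ ha
        · exact hbV
    · rintro ⟨hedge, hVe, hcr⟩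
      obtain ⟨a, b, ha, hbV, hb, hadj, rfl⟩ :
          ∃ a b, a ∈ A ∧ b ∈ V ∧ b ∉ A ∧ (zdStar d).Adj a b ∧ e = s(a, b) := by
        revert hedge hcr hVe
        induction e using Sym2.ind with
        | h u v =>
          intro hedge hVe hcr
          rw [crosses_mk] at hcr
          rw [mem_edgeSet] at hedge
          rcases hcr with ⟨hu, hv⟩ | ⟨hu, hv⟩
          · exact ⟨u, v, hu, hVe v (Sym2.mem_mk_right u v), hv, hedge, rfl⟩
          · exact ⟨v, u, hv, hVe u (Sym2.mem_mk_left u v), hu, hedge.symm, Sym2.eq_swap⟩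
      have heE : s(a, b) ∈ E := (hE _).2 ⟨a, b, ha, hbV, hb, hadj, rfl⟩
      by_cases hp : pick a b ∈ P₁
      · exact Or.inl (mem_filter.2 ⟨heE, a, b, ha, hb, rfl, hp⟩)
      · exact Or.inr (mem_filter.2 ⟨heE, a, b, ha, hb, rfl, hp⟩)
  have hdisj : Disjoint E₁ E₂ := by
    rw [Finset.disjoint_left]
    intro e h1 h2
    obtain ⟨-, a, b, ha, hb, rfl, hp⟩ := mem_filter.1 h1
    obtain ⟨-, a', b', ha', hb', heq, hp'⟩ := mem_filter.1 h2
    obtain ⟨rfl, rfl⟩ := horient a b a' b' ha hb ha' hb' heq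
    exact hp' hp
  have h1ne : E₁.Nonempty :=
    ⟨s(ax, bx), mem_filter.2 ⟨(hE _).2 ⟨ax, bx, hax, hbxV, hbx, hadjx, rfl⟩, ax, bx, hax, hbx, rfl, by
      rw [hpx]; exact ReflTransGen.refl⟩⟩
  have h2ne : E₂.Nonempty :=
    ⟨s(ay, cy), mem_filter.2 ⟨(hE _).2 ⟨ay, cy, hay, hcyV, hcy, hadjy, rfl⟩, ay, cy, hay, hcy, rfl, by
      rw [hpy]; exact hxy⟩⟩
  -- Lemma B.83 for the `★`-graph induced on `V`: one triangle of `V` meets both classes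
  obtain ⟨T, hT, ⟨e₁, he₁T, he₁⟩, ⟨e₂, he₂T, he₂⟩⟩ :=
    exists_generator_crossing_both_rel (G := zdStar d) (V := V)
      (𝒞 := {T | T ∈ starTriangles d ∧ ∀ e ∈ T, ∀ x ∈ e, x ∈ V})
      hgen
      (fun C hC => isEvenEdgeSet_of_mem_starTriangles hC.1)
      (fun C hC e he => ⟨mem_edgeSet_of_mem_starTriangles hC.1 he, hC.2 e he⟩)
      hAV hA' hAc' hEpart h1ne h2ne hdisj
  obtain ⟨he₁E, a₁, b₁, ha₁, hb₁, rfl, hp₁⟩ := mem_filter.1 he₁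
  obtain ⟨he₂E, a₂, b₂, ha₂, hb₂, rfl, hp₂⟩ := mem_filter.1 he₂
  have hadj₁ : (zdStar d).Adj a₁ b₁ ∧ b₁ ∈ V := by
    obtain ⟨a, b, ha, hbV, hb, hadj, heq⟩ := (hE _).1 he₁E
    obtain ⟨rfl, rfl⟩ := horient _ _ _ _ ha₁ hb₁ ha hb heq
    exact ⟨hadj, hbV⟩
  have hadj₂ : (zdStar d).Adj a₂ b₂ ∧ b₂ ∈ V := by
    obtain ⟨a, b, ha, hbV, hb, hadj, heq⟩ := (hE _).1 he₂E
    obtain ⟨rfl, rfl⟩ := horient _ _ _ _ ha₂ hb₂ ha hb heq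
    exact ⟨hadj, hbV⟩
  -- the two picked endpoints are distinct vertices of `T`, hence adjacent
  have hv₁ : pick a₁ b₁ ∈ s(a₁, b₁) := by
    rcases hpick a₁ b₁ with h | h <;> rw [h]
    · exact Sym2.mem_mk_left _ _
    · exact Sym2.mem_mk_right _ _
  have hv₂ : pick a₂ b₂ ∈ s(a₂, b₂) := by
    rcases hpick a₂ b₂ with h | h <;> rw [h]
    · exact Sym2.mem_mk_left _ _
    · exact Sym2.mem_mk_right _ _
  have hne : pick a₁ b₁ ≠ pick a₂ b₂ := fun h => hp₂ (h ▸ hp₁)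
  have hadj12 := adj_of_mem_starTriangle hT.1 he₁T hv₁ he₂T hv₂ hne
  have hP1 : pick a₁ b₁ ∈ P := ⟨a₁, b₁, ha₁, hadj₁.2, hb₁, hadj₁.1, rfl⟩
  have hP2 : pick a₂ b₂ ∈ P := ⟨a₂, b₂, ha₂, hadj₂.2, hb₂, hadj₂.1, rfl⟩
  exact hp₂ (ReflTransGen.tail hp₁ ⟨hadj12, hP1, hP2⟩)

/-- **Lemma B.82 relative to `V`, exterior boundary.** Under the generation hypothesis for `V`, if `A ⊆ V` and both `A` and `V ∖ A` are
`★`-connected, then `∂^ex_V A` (the points of `V ∖ A` `★`-adjacent to `A`) is `★`-connected.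
[cite: FriedliVelenik2017, App. B.15, Lemma B.82] [cite: Timar2013, Theorem 3] -/
theorem starConn_exBoundary_gen {V : Set (Site d)}
    (hgen : ∀ Z : Finset (Sym2 (Site d)), (∀ e ∈ Z, e ∈ (zdStar d).edgeSet ∧ ∀ x ∈ e, x ∈ V) → IsEvenEdgeSet Z →
      InSpan {T | T ∈ starTriangles d ∧ ∀ e ∈ T, ∀ x ∈ e, x ∈ V} Z)
    {A : Finset (Site d)} (hAV : ∀ a ∈ A, a ∈ V) (hA : StarConn (A : Set (Site d))) (hAc : StarConn (V \ ↑A)) :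
    StarConn {b | b ∈ V ∧ b ∉ A ∧ ∃ a ∈ A, (zdStar d).Adj a b} := by
  have h := starConn_boundary_pick_gen hgen hAV hA hAc (fun _ b => b) (fun _ _ => Or.inr rfl)
  have hset : {b | b ∈ V ∧ b ∉ A ∧ ∃ a ∈ A, (zdStar d).Adj a b} =
      {z | ∃ a b, a ∈ A ∧ b ∈ V ∧ b ∉ A ∧ (zdStar d).Adj a b ∧ b = z} := by
    ext z
    simp only [Set.mem_setOf_eq]
    constructor
    · rintro ⟨hzV, hz, a, ha, hadj⟩; exact ⟨a, z, ha, hzV, hz, hadj, rfl⟩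
    · rintro ⟨a, b, ha, hbV, hb, hadj, rfl⟩; exact ⟨hbV, hb, a, ha, hadj⟩
  rw [hset]; exact h

/-- **Lemma B.82 relative to `V`, interior boundary.** Under the generation hypothesis for `V`, if `A ⊆ V` and both `A` and `V ∖ A` are
`★`-connected, then `∂^in_V A` (the points of `A` `★`-adjacent to `V ∖ A`) is `★`-connected.
[cite: FriedliVelenik2017, App. B.15, Lemma B.82] [cite: Timar2013, Theorem 3] -/
theorem starConn_inBoundary_gen {V : Set (Site d)}
    (hgen : ∀ Z : Finset (Sym2 (Site d)), (∀ e ∈ Z, e ∈ (zdStar d).edgeSet ∧ ∀ x ∈ e, x ∈ V) → IsEvenEdgeSet Z →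
      InSpan {T | T ∈ starTriangles d ∧ ∀ e ∈ T, ∀ x ∈ e, x ∈ V} Z)
    {A : Finset (Site d)} (hAV : ∀ a ∈ A, a ∈ V) (hA : StarConn (A : Set (Site d))) (hAc : StarConn (V \ ↑A)) :
    StarConn {x | x ∈ A ∧ ∃ y ∈ V, y ∉ A ∧ (zdStar d).Adj x y} := by
  have h := starConn_boundary_pick_gen hgen hAV hA hAc (fun a _ => a) (fun _ _ => Or.inl rfl)
  have hset : {x | x ∈ A ∧ ∃ y ∈ V, y ∉ A ∧ (zdStar d).Adj x y} =
      {z | ∃ a b, a ∈ A ∧ b ∈ V ∧ b ∉ A ∧ (zdStar d).Adj a b ∧ a = z} := by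
    ext z
    simp only [Set.mem_setOf_eq]
    constructor
    · rintro ⟨hz, b, hbV, hb, hadj⟩; exact ⟨z, b, hz, hbV, hb, hadj, rfl⟩
    · rintro ⟨a, b, ha, hbV, hb, hadj, rfl⟩; exact ⟨ha, b, hbV, hb, hadj⟩
  rw [hset]; exact h

/-! ## The components form -/

/-- **The complement in `V` of a `★`-component is `★`-connected.** Let `V` be `★`-connected, `K ⊆ V` `★`-connected, and `A` disjoint from
`K`, closed under `★`-steps inside `V ∖ K` (a `★`-component of `V ∖ K`, or a union of such). Then `V ∖ A` is `★`-connected: from any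
point of `V ∖ A` a chain inside `V` reaches `K` before it can enter `A`, and `K` is `★`-connected.
[cite: FriedliVelenik2017, §7.2.6, Exercise 7.11] [cite: DeuschelPisztora1996, Lemma 2.1 (ii) (p. 471)] -/
theorem starConn_sdiff_of_starComponent_gen {V : Set (Site d)} (hV : StarConn V) {K A : Finset (Site d)}
    (hKV : ∀ z ∈ K, z ∈ V) (hK : StarConn (K : Set (Site d))) (hAK : Disjoint A K)
    (hmax : ∀ x ∈ V, x ∉ K → ∀ a ∈ A, (zdStar d).Adj a x → x ∈ A) :
    StarConn (V \ ↑A) := by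
  classical
  set W : Set (Site d) := V \ ↑A with hW
  have hKW : (K : Set (Site d)) ⊆ W := fun z hz =>
    ⟨hKV z (mem_coe.1 hz), fun hzA => Finset.disjoint_left.1 hAK (mem_coe.1 hzA) (mem_coe.1 hz)⟩
  -- walking inside `V` from a point of `W`: we stay in `W` until we reach the target or `K`
  have hit : ∀ (u w : Site d), ReflTransGen (starRel V) u w → u ∈ W →
      ∃ z, ReflTransGen (starRel W) u z ∧ (z = w ∨ z ∈ K) := by
    intro u w huw
    refine ReflTransGen.head_induction_on huw (fun _ => ⟨w, ReflTransGen.refl, Or.inl rfl⟩) ?_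
    intro a c hac _ ih ha
    by_cases haK : a ∈ K
    · exact ⟨a, ReflTransGen.refl, Or.inr haK⟩
    · have hcA : c ∉ A := fun hcA => ha.2 (mem_coe.2 (hmax a hac.2.1 haK c hcA hac.1.symm))
      have hc : c ∈ W := ⟨hac.2.2, fun h => hcA (mem_coe.1 h)⟩
      obtain ⟨z, hcz, hz⟩ := ih hc
      exact ⟨z, ReflTransGen.head ⟨hac.1, ha, hc⟩ hcz, hz⟩
  intro u hu v hv
  obtain ⟨z, huz, hz⟩ := hit u v (hV u hu.1 v hv.1) hu
  rcases hz with rfl | hzK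
  · exact huz
  obtain ⟨z', hvz', hz'⟩ := hit v u (hV v hv.1 u hu.1) hv
  rcases hz' with rfl | hz'K
  · exact reflTransGen_starRel_symm hvz'
  exact (huz.trans (reflTransGen_starRel_mono hKW (hK z (mem_coe.2 hzK) z' (mem_coe.2 hz'K)))).trans
    (reflTransGen_starRel_symm hvz')

/-- **Lemma B.82 relative to `V`, components form.** Let `V` be `★`-connected with the generation hypothesis, `K ⊆ V` `★`-connected,
and `A ⊆ V` a `★`-component of `V ∖ K` (`★`-connected, disjoint from `K`, closed under `★`-steps inside `V ∖ K`). Then for every endpoint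
choice `pick a b ∈ {a, b}` the picked endpoints of the `★`-edges `ab`, `a ∈ A`, `b ∈ V ∖ A`, form a `★`-connected set — in particular the
relative boundaries `∂^ex_V A ⊆ K` and `∂^in_V A` are `★`-connected.
[cite: FriedliVelenik2017, App. B.15, Lemma B.82 with §7.2.6 Exercise 7.11] [cite: DeuschelPisztora1996, Lemma 2.1 (ii) (p. 471)] -/
theorem starConn_boundary_pick_gen_of_starComponent {V : Set (Site d)} (hV : StarConn V)
    (hgen : ∀ Z : Finset (Sym2 (Site d)), (∀ e ∈ Z, e ∈ (zdStar d).edgeSet ∧ ∀ x ∈ e, x ∈ V) → IsEvenEdgeSet Z →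
      InSpan {T | T ∈ starTriangles d ∧ ∀ e ∈ T, ∀ x ∈ e, x ∈ V} Z)
    {K A : Finset (Site d)} (hKV : ∀ z ∈ K, z ∈ V) (hK : StarConn (K : Set (Site d)))
    (hAV : ∀ a ∈ A, a ∈ V) (hAK : Disjoint A K) (hA : StarConn (A : Set (Site d)))
    (hmax : ∀ x ∈ V, x ∉ K → ∀ a ∈ A, (zdStar d).Adj a x → x ∈ A)
    (pick : Site d → Site d → Site d) (hpick : ∀ a b, pick a b = a ∨ pick a b = b) :
    StarConn {z | ∃ a b, a ∈ A ∧ b ∈ V ∧ b ∉ A ∧ (zdStar d).Adj a b ∧ pick a b = z} :=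
  starConn_boundary_pick_gen hgen hAV hA (starConn_sdiff_of_starComponent_gen hV hKV hK hAK hmax) pick hpick

/-- **The interior boundary of the outer component consists of points `★`-adjacent to `K`.**  If `A` is closed under `★`-steps inside
`V ∖ K`, every point of `V ∖ A` that is `★`-adjacent to `A` lies in `K`; so `∂^in_V A = {x ∈ A | x ★-adjacent to K}` when `K ★ A`-contacts
are read inside `V`. [cite: FriedliVelenik2017, §7.2.6] -/
theorem mem_K_of_adj_of_starComponent {V : Set (Site d)} {K A : Finset (Site d)}
    (hmax : ∀ x ∈ V, x ∉ K → ∀ a ∈ A, (zdStar d).Adj a x → x ∈ A)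
    {a y : Site d} (ha : a ∈ A) (hyV : y ∈ V) (hyA : y ∉ A) (hadj : (zdStar d).Adj a y) : y ∈ K := by
  by_contra hyK
  exact hyA (hmax y hyV hyK a ha hadj)

/-- **Components form, interior boundary spelled out**: with `V`, `K`, `A` as in `starConn_boundary_pick_gen_of_starComponent`, the set
`{x ∈ A | ∃ y ∈ K, x ★-adjacent to y}` of points of the component touching `K` is `★`-connected.
[cite: FriedliVelenik2017, App. B.15, Lemma B.82 with §7.2.6 Exercise 7.11] [cite: DeuschelPisztora1996, Lemma 2.1 (ii) (p. 471)] -/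
theorem starConn_contact_of_starComponent {V : Set (Site d)} (hV : StarConn V)
    (hgen : ∀ Z : Finset (Sym2 (Site d)), (∀ e ∈ Z, e ∈ (zdStar d).edgeSet ∧ ∀ x ∈ e, x ∈ V) → IsEvenEdgeSet Z →
      InSpan {T | T ∈ starTriangles d ∧ ∀ e ∈ T, ∀ x ∈ e, x ∈ V} Z)
    {K A : Finset (Site d)} (hKV : ∀ z ∈ K, z ∈ V) (hK : StarConn (K : Set (Site d)))
    (hAV : ∀ a ∈ A, a ∈ V) (hAK : Disjoint A K) (hA : StarConn (A : Set (Site d)))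
    (hmax : ∀ x ∈ V, x ∉ K → ∀ a ∈ A, (zdStar d).Adj a x → x ∈ A) :
    StarConn {x | x ∈ A ∧ ∃ y ∈ K, (zdStar d).Adj x y} := by
  have h := starConn_boundary_pick_gen_of_starComponent hV hgen hKV hK hAV hAK hA hmax (fun a _ => a) (fun _ _ => Or.inl rfl)
  have hset : {x | x ∈ A ∧ ∃ y ∈ K, (zdStar d).Adj x y} =
      {z | ∃ a b, a ∈ A ∧ b ∈ V ∧ b ∉ A ∧ (zdStar d).Adj a b ∧ a = z} := by
    ext z
    simp only [Set.mem_setOf_eq]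
    constructor
    · rintro ⟨hz, y, hyK, hadj⟩
      exact ⟨z, y, hz, hKV y hyK, fun hyA => Finset.disjoint_left.1 hAK hyA hyK, hadj, rfl⟩
    · rintro ⟨a, b, ha, hbV, hb, hadj, rfl⟩
      exact ⟨ha, b, mem_K_of_adj_of_starComponent hmax ha hbV hb hadj, hadj⟩
  rw [hset]; exact h

end StarRetract

end Summit.CriticalPhenomena.PercolationContinuityZ3.Theorems.Transplant

end
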